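import Summits.RiemannHypothesis.RiemannHypothesis.Theorems.LiEchoSieveDefs
import Summits.RiemannHypothesis.RiemannHypothesis.Theorems.LiPrimeEchoLawProof
import Summits.RiemannHypothesis.RiemannHypothesis.Theorems.LiDirichletEchoComplexLaw
import HarnessLib

/-!
# RiemannHypothesis / LI column — the DIRICHLET ECHO SIEVE is a theorem (RH-FREE, GRH-FREE PROOF-OF-DATA)

RH-FREE [rh-li-prover].  Cell `pub/rh-li`; PART G (`Theorems/LiEchoSieveDefs.lean`, rh-li-theory g7) types the echo sieve
`LiEchoSieve` — for a prime `q ≥ 3`, a unit `b mod q` and `c ≥ 5/4`,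

  `‖(1/φ(q)) Σ_χ χ(b) D_χ(n; √n, c√n) + [b = 2]·E₂(n)‖ ≤ C log² n`  (`n ≥ 2`),

i.e. averaging the per-character window discrepancies with the weights `χ(b)` isolates the residue class of the resonating
prime `2` — together with the PROVED reduction `liEchoSieve_of : LiZeroWindowEcho → LiZeroWindowEchoDirichletComplex →
LiEchoSieve`.  Both hypotheses are now theorems of the tree: the ζ echo law `liZeroWindowEcho_proof` (leaf of route
`Theses/LiPrimeEcho.lean`, CLOSED·proved; `Theorems/LiPrimeEchoLawProof.lean`) and the complex Dirichlet echo law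
`liZeroWindowEchoDirichletComplex_holds` (`Theorems/LiDirichletEchoComplexLaw.lean`, companion of the leaf of route
`Theses/LiDirichletEcho.lean`, CLOSED·proved).  This module records the one-line composition, turning PART G's
`@[conjecture]` into a theorem.  WHAT THIS IS NOT: anything about the real parts of zeros of `ζ` or of any `L(s, χ)`;
nothing here bears on the truth of RH or GRH.
-/

noncomputable section

-- D-0017: `Summit.<S>.<S>.…` is the designed namespace of a single-problem summit.
set_option linter.dupNamespace false

namespace Summit.RiemannHypothesis.RiemannHypothesis.Theorems.LiTheory

/-- **The DIRICHLET ECHO SIEVE (PART G target `LiEchoSieve`) holds — RH-FREE, GRH-FREE PROOF-OF-DATA:** for every prime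
`q ≥ 3`, unit `b mod q` and `c ≥ 5/4` there is `C` with
`‖liEchoClassStat q b c n + [b = 2]·liPrimeEcho 2 n‖ ≤ C log² n` for all `n ≥ 2` (the class of `2 mod q` carries the
`n^{1/4}` chirp of the prime `2`, every other class is silent).  Composition of the PROVED reduction `liEchoSieve_of` with
the two PROVED echo laws `liZeroWindowEcho_proof` and `liZeroWindowEchoDirichletComplex_holds`. -/
theorem liEchoSieve_holds : LiEchoSieve :=
  liEchoSieve_of liZeroWindowEcho_proof liZeroWindowEchoDirichletComplex_holds

end Summit.RiemannHypothesis.RiemannHypothesis.Theorems.LiTheory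

end
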